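import Literature.MathematicalPhysics.QuantumFieldTheory.ConstructiveQFTWave0SiteRPProofs
import Literature.MathematicalPhysics.QuantumFieldTheory.LatticeGaugeProofs
import HarnessLib

/-!
# Reflection positivity in hyperplanes through sites for a general class-function plaquette weight

Theorem-only generalisation of `ConstructiveQFTWave0SiteRPProofs` (Osterwalder–Seiler /
Fröhlich–Israel–Lieb–Simon reflection positivity of the torus Wilson measure for the reflection
`θ' t = -t` in the lattice hyperplanes `t = 0`, `t = L/2`): the Wilson density
`exp(β Σ_p Re tr ρ(U_p))` is replaced by `exp(J Σ_p w(U_p))` for an ARBITRARY continuous weight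
`w : G → ℝ` which is a class function invariant under inversion
(`w(h g h⁻¹) = w(g)`, `w(g⁻¹) = w(g)`) — e.g. any function of `Re tr ρ(U_p)` for a unitary `ρ`, such
as the narrow-well action `((1 + ½ Re tr U_p)/2)^p` of van Enter–Shlosman
(`Literature.MathematicalPhysics.QuantumLattice.NarrowWell.weight`), heat-kernel actions, or
character ("Potts gauge") actions. The statement (`integral_conj_negReflect_mul_exp_nonneg`): for
`L` even, every real `J` and every bounded measurable observable `F` depending only on the links of
the closed positive-time half (`WilsonSiteRP.sitePosEdges ∪ WilsonSiteRP.sharedEdges`),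

  `0 ≤ ∫ conj F(Θ'U) · F(U) · exp(J Σ_p w(U_p)) d(⊗_e Haar)(U)`.

No sign condition on `J` and no positive-type property of `w` are needed: each plaquette lies in
one closed half ("reflection through sites", FILS 1978 Thm. 2.1). This is the reflection positivity
behind chessboard estimates for lattice gauge models with cell events (Kotecký–Shlosman 1982;
van Enter–Shlosman 2005, Thm. 2).

The proof is that of the parent file verbatim, with `Re tr ρ(U_p)` replaced by `w(U_p)`: the
geometry of `Θ'` (`GaugeConfig.negReflect`, the classification of links and plaquettes, measure
preservation `WilsonSiteRP.measurePreserving_negReflect`) is imported; the weight-dependent steps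
(`plaqW_negReflect`: `w((Θ'U)_p) = w(U_{ϑ'p})` by the class-function and inversion invariance;
the splitting `Σ_p w(U_p) = A'(U) + A'(Θ'U) + S_M(U)`; the observable `g = F e^{J A'} e^{J S_M/2}`)
are redone, and the abstract engine with a shared block
`LatticeRP.integral_splice_mul_conj_comp_of_shared_nonneg` concludes. Measurability uses second
countability of `G` (true for all matrix groups). Everything here is proved; no definitions of
facts.

## References

* J. Fröhlich, R. Israel, E. H. Lieb, B. Simon, Comm. Math. Phys. 62 (1978) 1–34, Thm. 2.1
  (reflection through sites) [FrohlichIsraelLiebSimon1978].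
* K. Osterwalder, E. Seiler, Ann. Phys. 110 (1978) 440–471, §2 [OsterwalderSeilerAnnPhys1978].
* R. Kotecký, S. B. Shlosman, Comm. Math. Phys. 83 (1982) 493–515 [KoteckyShlosman1982].
* A. C. D. van Enter, S. B. Shlosman, Comm. Math. Phys. 255 (2005) 21–32 [VanEnterShlosman2005].
-/

open MeasureTheory Finset Complex
open scoped ComplexOrder ENNReal ComplexConjugate

namespace Literature.MathematicalPhysics.QuantumFieldTheory

noncomputable section

namespace WeightSiteRP

open WilsonRP WilsonSiteRP

/-! ## The weight of a plaquette and its behaviour under the site reflection -/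

section Action

variable {d L : ℕ} [NeZero d] [NeZero L] [Fact (1 < L)]
variable {G : Type*} [Group G] (w : G → ℝ)

/-- `w(U_p)` for a plaquette `p = (x, i<j)`. [folklore] -/
def plaqW (U : GaugeConfig d L G) (p : Plaquette d L) : ℝ :=
  w (plaquetteHolonomy U p.1 p.2.1.1 p.2.1.2)

/-- The positive part `A'(U) = Σ_{p positive} w(U_p)` of the energy. [folklore] -/
def posW (U : GaugeConfig d L G) : ℝ := ∑ p ∈ univ.filter IsSitePosPlaq, plaqW w U p

/-- The shared part `S_M(U) = Σ_{p shared} w(U_p)` of the energy. [folklore] -/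
def sharedW (U : GaugeConfig d L G) : ℝ := ∑ p ∈ univ.filter IsSharedPlaq, plaqW w U p

omit [NeZero L] [Fact (1 < L)] in
/-- `w((Θ'U)_p) = w(U_{ϑ'p})` for an inversion-invariant class function `w`: the reflected holonomy
is the holonomy of the reflected plaquette (spatial plaquettes) or a conjugate of its inverse
(temporal plaquettes). [folklore] -/
theorem plaqW_negReflect (hcl : ∀ g h : G, w (h * g * h⁻¹) = w g) (hinv : ∀ g : G, w g⁻¹ = w g)
    (U : GaugeConfig d L G) (p : Plaquette d L) :
    plaqW w U.negReflect p = plaqW w U (sitePlaqReflect p) := by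
  obtain ⟨x, ⟨⟨i, j⟩, hij⟩⟩ := p
  have hj : j ≠ 0 := plaq_snd_ne_zero (x, ⟨(i, j), hij⟩)
  unfold plaqW sitePlaqReflect plaquetteHolonomy
  simp only [negReflect_apply, siteEdgeReflect, hj, ↓reduceIte]
  by_cases hi : i = 0
  · subst hi
    simp only [↓reduceIte]
    rw [negReflect_shift_shift_zero _ hj, ← negReflect_shift_shift x]
    set y := (x.shift 0).negReflect
    rw [show (U (y, 0))⁻¹ * U (y, j) * ((U (y.shift j, 0))⁻¹)⁻¹ * (U (y.shift 0, j))⁻¹ =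
        (U (y, 0))⁻¹ * (U (y, 0) * U (y.shift 0, j) * (U (y.shift j, 0))⁻¹ * (U (y, j))⁻¹)⁻¹ *
          ((U (y, 0))⁻¹)⁻¹ by group, hcl, hinv]
  · simp only [hi, ↓reduceIte]
    rw [negReflect_shift_of_ne _ hi, negReflect_shift_of_ne _ hj]

/-- The negative part of the energy is the positive part of the reflected configuration. [folklore] -/
theorem sum_neg_eq_posW_negReflect (hL : Even L) (hcl : ∀ g h : G, w (h * g * h⁻¹) = w g)
    (hinv : ∀ g : G, w g⁻¹ = w g) (U : GaugeConfig d L G) :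
    ∑ p ∈ univ.filter IsSiteNegPlaq, plaqW w U p = posW w U.negReflect := by
  unfold posW
  simp_rw [plaqW_negReflect w hcl hinv]
  symm
  refine Finset.sum_equiv sitePlaqReflectEquiv (fun p => ?_) (fun p _ => rfl)
  simp only [Finset.mem_filter, Finset.mem_univ, true_and]
  exact (isSiteNegPlaq_sitePlaqReflect_iff hL p).symm

/-- `Σ_p w(U_p) = A'(U) + A'(Θ'U) + S_M(U)`. [folklore] -/
theorem sum_plaqW_eq_site (hL : Even L) (hcl : ∀ g h : G, w (h * g * h⁻¹) = w g)
    (hinv : ∀ g : G, w g⁻¹ = w g) (U : GaugeConfig d L G) :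
    ∑ p, plaqW w U p = posW w U + posW w U.negReflect + sharedW w U := by
  have h1 : ∑ p, plaqW w U p = ∑ p ∈ univ.filter IsSitePosPlaq, plaqW w U p +
      ∑ p ∈ univ.filter (fun p => ¬ IsSitePosPlaq p), plaqW w U p :=
    (Finset.sum_filter_add_sum_filter_not univ IsSitePosPlaq _).symm
  have h2 : ∑ p ∈ univ.filter (fun p => ¬ IsSitePosPlaq p), plaqW w U p =
      ∑ p ∈ univ.filter IsSharedPlaq, plaqW w U p + ∑ p ∈ univ.filter IsSiteNegPlaq, plaqW w U p := by
    rw [← Finset.sum_filter_add_sum_filter_not (univ.filter fun p => ¬ IsSitePosPlaq p) IsSharedPlaq,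
      Finset.filter_filter, Finset.filter_filter]
    have hC : (univ.filter fun p : Plaquette d L => ¬ IsSitePosPlaq p ∧ IsSharedPlaq p) =
        univ.filter IsSharedPlaq :=
      Finset.filter_congr fun p _ => ⟨fun h => h.2, fun h => ⟨not_isSitePosPlaq_of_isSharedPlaq h, h⟩⟩
    have hN : (univ.filter fun p : Plaquette d L => ¬ IsSitePosPlaq p ∧ ¬ IsSharedPlaq p) =
        univ.filter IsSiteNegPlaq :=
      Finset.filter_congr fun p _ => Iff.rfl
    rw [hC, hN]
  rw [h1, h2, sum_neg_eq_posW_negReflect w hL hcl hinv]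
  unfold posW sharedW
  ring

/-- The positive part of the energy depends only on the links in `P' ∪ M`. [folklore] -/
theorem dependsOn_posW (hL : Even L) :
    DependsOn (posW (d := d) (L := L) w)
      ((sitePosEdges ∪ sharedEdges : Finset (Edge d L)) : Set (Edge d L)) := by
  intro U V hUV
  unfold posW
  refine Finset.sum_congr rfl fun p hp => ?_
  rw [Finset.mem_filter] at hp
  obtain ⟨h1, h2, h3, h4⟩ := edges_of_isSitePosPlaq hL hp.2
  have h : ∀ e, IsSitePosEdge e ∨ IsSharedEdge e → U e = V e := fun e he => hUV e (by
    rcases he with he | he <;> simp [he])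
  simp only [plaqW, plaquetteHolonomy, h _ h1, h _ h2, h _ h3, h _ h4]

omit [Fact (1 < L)] in
/-- The shared part of the energy depends only on the links in `M`. [folklore] -/
theorem dependsOn_sharedW :
    DependsOn (sharedW (d := d) (L := L) w) ((sharedEdges : Finset (Edge d L)) : Set (Edge d L)) := by
  intro U V hUV
  unfold sharedW
  refine Finset.sum_congr rfl fun p hp => ?_
  rw [Finset.mem_filter] at hp
  obtain ⟨h1, h2, h3, h4⟩ := edges_of_isSharedPlaq hp.2
  have h : ∀ e, IsSharedEdge e → U e = V e := fun e he => hUV e (by simp [he])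
  simp only [plaqW, plaquetteHolonomy, h _ h1, h _ h2, h _ h3, h _ h4]

omit [Fact (1 < L)] in
/-- The shared part of the energy is reflection invariant. [folklore] -/
theorem sharedW_negReflect (hL : Even L) (U : GaugeConfig d L G) :
    sharedW w U.negReflect = sharedW w U :=
  dependsOn_sharedW w fun e he => negReflect_apply_of_mem_sharedEdges hL U e (Finset.mem_coe.1 he)

omit [NeZero d] [Fact (1 < L)] in
/-- A sum of weights over a sub-family of plaquettes is bounded by `C · #plaquettes` when `|w| ≤ C`.
[folklore] -/
theorem abs_sum_plaqW_le {C : ℝ} (hC : ∀ g, |w g| ≤ C) (U : GaugeConfig d L G)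
    (s : Finset (Plaquette d L)) :
    |∑ p ∈ s, plaqW w U p| ≤ C * Fintype.card (Plaquette d L) := by
  have hC0 : 0 ≤ C := (abs_nonneg _).trans (hC 1)
  calc |∑ p ∈ s, plaqW w U p| ≤ ∑ p ∈ s, |plaqW w U p| := Finset.abs_sum_le_sum_abs _ _
    _ ≤ ∑ _p ∈ s, C := Finset.sum_le_sum fun p _ => hC _
    _ ≤ ∑ _p : Plaquette d L, C :=
        Finset.sum_le_sum_of_subset_of_nonneg (Finset.subset_univ _) fun _ _ _ => hC0
    _ = C * Fintype.card (Plaquette d L) := by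
        rw [Finset.sum_const, Finset.card_univ, nsmul_eq_mul, mul_comm]

variable [TopologicalSpace G] [IsTopologicalGroup G] [MeasurableSpace G] [BorelSpace G]
  [SecondCountableTopology G]

omit [NeZero d] [NeZero L] [Fact (1 < L)] in
/-- `U ↦ w(U_p)` is measurable for continuous `w` (second-countable `G`). [folklore] -/
theorem measurable_plaqW (hw : Continuous w) (p : Plaquette d L) :
    Measurable fun U : GaugeConfig d L G => plaqW w U p :=
  hw.measurable.comp (measurable_plaquetteHolonomy _ _ _)

omit [Fact (1 < L)] in
/-- The positive part of the energy is measurable. [folklore] -/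
theorem measurable_posW (hw : Continuous w) : Measurable (posW (d := d) (L := L) (G := G) w) :=
  Finset.measurable_sum _ fun p _ => measurable_plaqW w hw p

omit [Fact (1 < L)] in
/-- The shared part of the energy is measurable. [folklore] -/
theorem measurable_sharedW (hw : Continuous w) :
    Measurable (sharedW (d := d) (L := L) (G := G) w) :=
  Finset.measurable_sum _ fun p _ => measurable_plaqW w hw p

end Action

/-! ## The observable `g = F e^{J A'} e^{J S_M / 2}` -/

section Obs

variable {d L : ℕ} [NeZero d] [NeZero L] [Fact (1 < L)]
variable {G : Type*} [Group G] [TopologicalSpace G] [IsTopologicalGroup G]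
  [MeasurableSpace G] [BorelSpace G] [SecondCountableTopology G] (w : G → ℝ)

/-- The observable `g = F · exp(J A') · exp(J S_M / 2)`. [folklore] -/
def siteObsW (J : ℝ) (F : GaugeConfig d L G → ℂ) (V : GaugeConfig d L G) : ℂ :=
  F V * (Real.exp (J * posW w V + J / 2 * sharedW w V) : ℂ)

omit [Fact (1 < L)] in
/-- `g` is measurable. [folklore] -/
theorem measurable_siteObsW (hw : Continuous w) (J : ℝ) {F : GaugeConfig d L G → ℂ}
    (hF : Measurable F) : Measurable (siteObsW w J F) :=
  hF.mul (Complex.measurable_ofReal.comp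
    (((measurable_posW w hw).const_mul J).add ((measurable_sharedW w hw).const_mul (J / 2))).exp)

omit [Fact (1 < L)] [TopologicalSpace G] [IsTopologicalGroup G] [MeasurableSpace G] [BorelSpace G]
  [SecondCountableTopology G] in
/-- `g` is bounded. [folklore] -/
theorem norm_siteObsW_le (J : ℝ) {C : ℝ} (hC : ∀ g, |w g| ≤ C) {F : GaugeConfig d L G → ℂ}
    {CF : ℝ} (hFb : ∀ U, ‖F U‖ ≤ CF) (V : GaugeConfig d L G) :
    ‖siteObsW w J F V‖ ≤ |CF| * Real.exp ((|J| + |J / 2|) * (C * Fintype.card (Plaquette d L))) := by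
  rw [siteObsW, norm_mul, Complex.norm_real, Real.norm_eq_abs, abs_of_pos (Real.exp_pos _)]
  refine mul_le_mul ((hFb V).trans (le_abs_self _)) ?_ (Real.exp_pos _).le (abs_nonneg _)
  refine Real.exp_le_exp.2 ?_
  rw [add_mul]
  refine add_le_add ?_ ?_
  · calc J * posW w V ≤ |J * posW w V| := le_abs_self _
      _ = |J| * |posW w V| := abs_mul _ _
      _ ≤ |J| * (C * Fintype.card (Plaquette d L)) :=
          mul_le_mul_of_nonneg_left (abs_sum_plaqW_le w hC V _) (abs_nonneg _)
  · calc J / 2 * sharedW w V ≤ |J / 2 * sharedW w V| := le_abs_self _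
      _ = |J / 2| * |sharedW w V| := abs_mul _ _
      _ ≤ |J / 2| * (C * Fintype.card (Plaquette d L)) :=
          mul_le_mul_of_nonneg_left (abs_sum_plaqW_le w hC V _) (abs_nonneg _)

omit [TopologicalSpace G] [IsTopologicalGroup G] [MeasurableSpace G] [BorelSpace G]
  [SecondCountableTopology G] in
/-- `g` depends only on the links in `P' ∪ M` (stated for `P' ∪ ∅ ∪ M`). [folklore] -/
theorem dependsOn_siteObsW (hL : Even L) (J : ℝ) {F : GaugeConfig d L G → ℂ}
    (hFdep : DependsOn F ((sitePosEdges ∪ sharedEdges : Finset (Edge d L)) : Set (Edge d L))) :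
    DependsOn (siteObsW w J F)
      ((sitePosEdges ∪ ∅ ∪ sharedEdges : Finset (Edge d L)) : Set (Edge d L)) := by
  intro U V hUV
  rw [Finset.union_empty] at hUV
  have hM : ∀ e ∈ ((sharedEdges : Finset (Edge d L)) : Set (Edge d L)), U e = V e := fun e he =>
    hUV e (by rw [Finset.coe_union]; exact Or.inr he)
  simp only [siteObsW, hFdep hUV, dependsOn_posW w hL hUV, dependsOn_sharedW w hM]

omit [TopologicalSpace G] [IsTopologicalGroup G] [MeasurableSpace G] [BorelSpace G]
  [SecondCountableTopology G] in
/-- **The pointwise identity**: `e^{J Σ_p w(U_p)} conj F(Θ'U) F(U) = g(U) conj g(Θ'U)`. [folklore] -/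
theorem siteIntegrandW_eq (hL : Even L) (hcl : ∀ g h : G, w (h * g * h⁻¹) = w g)
    (hinv : ∀ g : G, w g⁻¹ = w g) (J : ℝ) (F : GaugeConfig d L G → ℂ) (U : GaugeConfig d L G) :
    (Real.exp (J * ∑ p, plaqW w U p) : ℂ) * (conj (F U.negReflect) * F U) =
      siteObsW w J F U * conj (siteObsW w J F U.negReflect) := by
  rw [sum_plaqW_eq_site w hL hcl hinv U]
  unfold siteObsW
  rw [sharedW_negReflect w hL U]
  simp only [map_mul, Complex.conj_ofReal]
  rw [show J * (posW w U + posW w U.negReflect + sharedW w U) =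
      (J * posW w U + J / 2 * sharedW w U) + (J * posW w U.negReflect + J / 2 * sharedW w U) by ring,
    Real.exp_add]
  push_cast
  ring

end Obs

/-! ## Assembly -/

section Assembly

variable {d L : ℕ} [NeZero d] [NeZero L] [Fact (1 < L)]
variable {G : Type*} [Group G] [TopologicalSpace G] [IsTopologicalGroup G] [CompactSpace G]
  [MeasurableSpace G] [BorelSpace G] [SecondCountableTopology G] (w : G → ℝ)

/-- **Reflection positivity (through sites) of the un-normalised weight**:
`0 ≤ ∫ exp(J Σ_p w(U_p)) conj F(Θ'U) F(U) ∏ dU_e` for `F` bounded measurable depending only on the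
links of the closed positive-time half, every real `J`, and every continuous inversion-invariant
class function `w`. [cite: FrohlichIsraelLiebSimon1978, Thm. 2.1 (reflection through sites)] -/
theorem integral_siteIntegrandW_nonneg (hL : Even L) (hw : Continuous w)
    (hcl : ∀ g h : G, w (h * g * h⁻¹) = w g) (hinv : ∀ g : G, w g⁻¹ = w g) (J : ℝ)
    {F : GaugeConfig d L G → ℂ} (hF : Measurable F) {CF : ℝ} (hFb : ∀ U, ‖F U‖ ≤ CF)
    (hFdep : DependsOn F ((sitePosEdges ∪ sharedEdges : Finset (Edge d L)) : Set (Edge d L))) :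
    0 ≤ ∫ U : GaugeConfig d L G, (Real.exp (J * ∑ p, plaqW w U p) : ℂ) *
      (conj (F (GaugeConfig.negReflect U)) * F U) ∂(LatticeRP.piMeasure (haarProbability G)) := by
  obtain ⟨C, hC⟩ : ∃ C, ∀ g, |w g| ≤ C := by
    obtain ⟨C, hC⟩ := isCompact_univ.exists_bound_of_continuousOn hw.continuousOn
    exact ⟨C, fun g => by simpa [Real.norm_eq_abs] using hC g (Set.mem_univ g)⟩
  simp_rw [siteIntegrandW_eq w hL hcl hinv J F]
  have key := LatticeRP.integral_splice_mul_conj_comp_of_shared_nonneg (haarProbability G)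
    sharedEdges sitePosEdges (∅ : Finset (Edge d L)) GaugeConfig.negReflect
    measurePreserving_negReflect
    (fun U e he => negReflect_apply_of_mem_sharedEdges hL U e he)
    (fun e he => dependsOn_negReflect_apply hL e he) disjoint_sharedEdges_sitePosEdges
    (Finset.disjoint_empty_right _) (measurable_siteObsW w hw J hF) (norm_siteObsW_le w J hC hFb)
    (dependsOn_siteObsW w hL J hFdep)
  have hsplice : ∀ p : GaugeConfig d L G × GaugeConfig d L G,
      LatticeRP.splice (∅ : Finset (Edge d L)) p = p.1 := fun p => by
    funext i
    simp [LatticeRP.splice_apply]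
  simp_rw [hsplice] at key
  rw [integral_fun_fst (fun U : GaugeConfig d L G =>
      siteObsW w J F U * conj (siteObsW w J F (GaugeConfig.negReflect U))), probReal_univ,
    one_smul] at key
  exact key

end Assembly

end WeightSiteRP

/-! ## The theorem -/

section Main

variable {d L : ℕ} {G : Type*} [Group G] [TopologicalSpace G] [IsTopologicalGroup G]
  [CompactSpace G] [MeasurableSpace G] [BorelSpace G] [SecondCountableTopology G]

/-- **Reflection positivity in hyperplanes through sites for a class-function plaquette weight**
(Fröhlich–Israel–Lieb–Simon, Comm. Math. Phys. 62 (1978), Thm. 2.1, "reflection through sites";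
Osterwalder–Seiler, Ann. Phys. 110 (1978), §2). For a compact second-countable group `G`, a
continuous weight `w : G → ℝ` with `w(h g h⁻¹) = w(g)` and `w(g⁻¹) = w(g)`, ANY real `J`, the
torus `(ℤ/Lℤ)^d` with `L` even and the reflection `θ' t = -t` in the hyperplanes `t = 0`,
`t = L/2` through lattice sites: for every bounded measurable observable `F` depending only on the
links of the closed positive-time half `0 ≤ t ≤ L/2`
(`WilsonSiteRP.sitePosEdges ∪ WilsonSiteRP.sharedEdges`),
`∫ conj F(Θ'U) · F(U) · exp(J Σ_p w(U_p)) d(⊗_e Haar)(U) ≥ 0` (real and non-negative). The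
Gibbs measure `exp(J Σ_p w(U_p)) d(⊗ Haar)/Z` of the plaquette action `w` is therefore reflection
positive for `θ'`. [cite: FrohlichIsraelLiebSimon1978, Thm. 2.1 (reflection through sites)] -/
theorem integral_conj_negReflect_mul_exp_nonneg [NeZero d] [NeZero L] (hL : Even L)
    {w : G → ℝ} (hw : Continuous w) (hcl : ∀ g h : G, w (h * g * h⁻¹) = w g)
    (hinv : ∀ g : G, w g⁻¹ = w g) (J : ℝ) (F : GaugeConfig d L G → ℂ) (hF : Measurable F)
    (hFb : ∃ C : ℝ, ∀ U, ‖F U‖ ≤ C)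
    (hFdep : DependsOn F
      ((WilsonSiteRP.sitePosEdges ∪ WilsonSiteRP.sharedEdges : Finset (Edge d L)) : Set (Edge d L))) :
    0 ≤ ∫ U : GaugeConfig d L G, conj (F U.negReflect) * F U *
        (Real.exp (J * ∑ p : Plaquette d L, w (plaquetteHolonomy U p.1 p.2.1.1 p.2.1.2)) : ℂ)
      ∂(Measure.pi fun _ : Edge d L => haarProbability G) := by
  haveI : Fact (1 < L) := ⟨by
    obtain ⟨r, hr⟩ := hL
    have := NeZero.ne L
    omega⟩
  obtain ⟨CF, hFb⟩ := hFb
  have h := WeightSiteRP.integral_siteIntegrandW_nonneg w hL hw hcl hinv J hF hFb hFdep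
  have heq : ∀ U : GaugeConfig d L G, conj (F U.negReflect) * F U *
      (Real.exp (J * ∑ p : Plaquette d L, w (plaquetteHolonomy U p.1 p.2.1.1 p.2.1.2)) : ℂ) =
      (Real.exp (J * ∑ p, WeightSiteRP.plaqW w U p) : ℂ) * (conj (F U.negReflect) * F U) := by
    intro U
    simp only [WeightSiteRP.plaqW]
    ring
  simp_rw [heq]
  exact h

end Main

end

end Literature.MathematicalPhysics.QuantumFieldTheory
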